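import Mathlib.Analysis.Normed.Group.Basic
import Summits.Parity.GeneralizedHardyLittlewood.Theorems.GreenTaoLevelTwoMNTwoLocalQuadratic

/-!
# Route `GreenTaoLevelTwo`, crux `MNTwo` (stmt-Parity-21276), line `birth`, stub `stub_mnVertical`:
# major-arc locally quadratic phases satisfy the three-term bound (GT 2008b §12, (star-1))

Block V6 of the `stub_mnVertical` census (B. Green, T. Tao, *Quadratic uniformity of the Möbius
function*, Ann. Inst. Fourier 58 (2008) = arXiv:math/0606087, §12 "Handling the major arcs": from
the major-arc estimate `‖qφ''(h,h')‖_{ℝ/ℤ} ≲ ‖h‖_g‖h'‖_g` for `h, h' ∈ B_g(0,ρ₃)` (Lemma 28) and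
the Taylor expansion (taylor) one gets the approximate linearity (star-1)
`‖φ(n+h₁+h₂) − φ(n+h₁) − φ(n+h₂) + φ(n)‖ ≲ ε²` on small Bohr balls, which is fed to Prop. 15).
The printed derivation claims this "for `h₁, h₂` with `q ∣ h₁, h₂`" by bilinearity, which does not
follow (`‖h/q‖_g` is not controlled by `‖h‖_g`); it DOES follow for shifts of the form `h = q·a`
with `a` small, using local bilinearity in that slot only, and this is all that the three-term form
of Prop. 15 (`…MNTwoAlmostLinearThreeTerm`) needs.  This def-free file proves exactly that bridge,
in the abstract-gauge vocabulary of `…MNTwoLocalQuadratic` (any nonnegative subadditive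
gauge `ν` on `ℤ` — symmetry is not even needed — and any normed additive group of values):

* `norm_second_diff_qmul_le` — `‖φ(m + qa + b) − φ(m + qa) − φ(m + b) + φ(m)‖ ≤ K ν(a) ν(b)` for a
  base point `m ∈ B(n₀, r₁)`, `a` tiny and `b` small;
* `three_term_bound_of_major_arc` — **(star-1) in three-term form**: for `n, nₛ ∈ B(n₀,r₁)` with
  `ν(n − nₛ) < 2r` and `h_i = q a_i`, `ν(a_i) < η`:
  `‖φ(n) − φ(n+h₁+h₂) + φ(nₛ+h₁) + φ(nₛ+h₂) − 2φ(nₛ)‖ ≤ K η (qη + 4r)`.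

References: [GreenTao2008QuadraticMobius] arXiv:math/0606087 §12, eq. (star-1); §9 (taylor), (bilinear).
-/

namespace Summit.Parity.GeneralizedHardyLittlewood.GreenTaoLevelTwoMNTwoMajorArcThreeTerm

open Summit.Parity.GeneralizedHardyLittlewood.GreenTaoLevelTwoMNTwoLocalQuadratic
  (gauge_nsmul_le second_diff_eq_second_diff_center second_deriv_nsmul_left)

variable {G : Type*} [NormedAddCommGroup G]

/-- **One second difference with a `q`-multiple step.**  Let `φ` be locally quadratic on the gauge
ball `B(n₀, R)`, with the major-arc bound `‖q • φ''(a,b)‖ ≤ K ν(a) ν(b)` for `ν a, ν b < ρ`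
(`φ''` based at `n₀`).  If `ν(m − n₀) < r₁`, `q ν(a) < ρ`, `ν a < ρ`, `ν b < ρ`, `r₁ + 2ρ ≤ R` and
`3ρ ≤ R`, then `‖φ(m + qa + b) − φ(m + qa) − φ(m + b) + φ(m)‖ ≤ K ν(a) ν(b)`.
[cite: GreenTao2008QuadraticMobius, §12 eq. (star-1)] -/
theorem norm_second_diff_qmul_le (ν : ℤ → ℝ) (hν0 : ν 0 = 0) (hνnn : ∀ x, 0 ≤ ν x)
    (hνadd : ∀ x y, ν (x + y) ≤ ν x + ν y) (φ : ℤ → G) {n₀ : ℤ} {R : ℝ}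
    (hφ : ∀ n a b c : ℤ, ν (n - n₀) < R → ν (n + a - n₀) < R → ν (n + b - n₀) < R →
      ν (n + c - n₀) < R → ν (n + a + b - n₀) < R → ν (n + a + c - n₀) < R →
      ν (n + b + c - n₀) < R → ν (n + a + b + c - n₀) < R →
      φ (n + a + b + c) - φ (n + a + b) - φ (n + a + c) - φ (n + b + c)
        + φ (n + a) + φ (n + b) + φ (n + c) - φ n = 0)
    {q : ℕ} {K ρ r₁ : ℝ}
    (hMA : ∀ a b : ℤ, ν a < ρ → ν b < ρ →
      ‖q • (φ (n₀ + a + b) - φ (n₀ + a) - φ (n₀ + b) + φ n₀)‖ ≤ K * ν a * ν b)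
    (hR : r₁ + 2 * ρ ≤ R) (hρR : 3 * ρ ≤ R)
    {m a b : ℤ} (hm : ν (m - n₀) < r₁) (hqa : (q : ℝ) * ν a < ρ) (ha : ν a < ρ) (hb : ν b < ρ) :
    ‖φ (m + (q : ℤ) * a + b) - φ (m + (q : ℤ) * a) - φ (m + b) + φ m‖ ≤ K * ν a * ν b := by
  have hqa' : ν ((q : ℤ) * a) < ρ := lt_of_le_of_lt (gauge_nsmul_le ν hν0 hνadd a q) hqa
  -- Taylor: move the base point to `n₀`
  rw [second_diff_eq_second_diff_center ν hν0 hνnn hνadd φ hφ hm hqa' hb hR]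
  -- bilinearity in the first slot: pull out `q`
  rw [second_deriv_nsmul_left ν hν0 hνnn hνadd φ hφ q hqa ha hb hρR]
  exact hMA a b ha hb

/-- **Major arc ⇒ three-term bound (GT 2008b §12, (star-1), usable form).**  With the hypotheses
of `norm_second_diff_qmul_le`, let `n, nₛ ∈ B(n₀, r₁)` with `ν(n − nₛ) < 2r`, `2r ≤ ρ`, and let
`h_i = q a_i` with `ν(a_i) < η`, `0 < η`, `qη ≤ ρ`, `1 ≤ q`, `0 ≤ K`.  Then
`‖φ(n) − φ(n+h₁+h₂) + φ(nₛ+h₁) + φ(nₛ+h₂) − 2φ(nₛ)‖ ≤ K η (qη + 4r)`.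
[cite: GreenTao2008QuadraticMobius, §12 eq. (star-1)] -/
theorem three_term_bound_of_major_arc (ν : ℤ → ℝ) (hν0 : ν 0 = 0) (hνnn : ∀ x, 0 ≤ ν x)
    (hνadd : ∀ x y, ν (x + y) ≤ ν x + ν y) (φ : ℤ → G) {n₀ : ℤ} {R : ℝ}
    (hφ : ∀ n a b c : ℤ, ν (n - n₀) < R → ν (n + a - n₀) < R → ν (n + b - n₀) < R →
      ν (n + c - n₀) < R → ν (n + a + b - n₀) < R → ν (n + a + c - n₀) < R →
      ν (n + b + c - n₀) < R → ν (n + a + b + c - n₀) < R →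
      φ (n + a + b + c) - φ (n + a + b) - φ (n + a + c) - φ (n + b + c)
        + φ (n + a) + φ (n + b) + φ (n + c) - φ n = 0)
    {q : ℕ} (hq : 1 ≤ q) {K ρ r₁ r η : ℝ} (hK : 0 ≤ K) (hη : 0 < η)
    (hMA : ∀ a b : ℤ, ν a < ρ → ν b < ρ →
      ‖q • (φ (n₀ + a + b) - φ (n₀ + a) - φ (n₀ + b) + φ n₀)‖ ≤ K * ν a * ν b)
    (hR : r₁ + 2 * ρ ≤ R) (hρR : 3 * ρ ≤ R) (hr : 2 * r ≤ ρ) (hqη : (q : ℝ) * η ≤ ρ)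
    {n nₛ a₁ a₂ : ℤ} (hn : ν (n - n₀) < r₁) (hnₛ : ν (nₛ - n₀) < r₁) (hclose : ν (n - nₛ) < 2 * r)
    (ha₁ : ν a₁ < η) (ha₂ : ν a₂ < η) :
    ‖φ n - φ (n + (q : ℤ) * a₁ + (q : ℤ) * a₂) + φ (nₛ + (q : ℤ) * a₁) + φ (nₛ + (q : ℤ) * a₂)
        - 2 • φ nₛ‖ ≤ K * η * (q * η + 4 * r) := by
  have hq1 : (1 : ℝ) ≤ q := by exact_mod_cast hq
  have hηρ : η ≤ ρ := by nlinarith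
  -- sizes
  have hqa₁ : (q : ℝ) * ν a₁ < ρ := by nlinarith [hνnn a₁]
  have hqa₂ : (q : ℝ) * ν a₂ < ρ := by nlinarith [hνnn a₂]
  have ha₁ρ : ν a₁ < ρ := by linarith
  have ha₂ρ : ν a₂ < ρ := by linarith
  have hqa₂' : ν ((q : ℤ) * a₂) < ρ := lt_of_le_of_lt (gauge_nsmul_le ν hν0 hνadd a₂ q) hqa₂
  have hqa₂η : ν ((q : ℤ) * a₂) ≤ q * η := by
    have := gauge_nsmul_le ν hν0 hνadd a₂ q; nlinarith
  have hd : ν (n - nₛ) < ρ := by linarith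
  -- the three second differences
  have L3 := norm_second_diff_qmul_le ν hν0 hνnn hνadd φ hφ hMA hR hρR hn hqa₁ ha₁ρ hqa₂'
  have L1 := norm_second_diff_qmul_le ν hν0 hνnn hνadd φ hφ hMA hR hρR hnₛ hqa₁ ha₁ρ hd
  have L2 := norm_second_diff_qmul_le ν hν0 hνnn hνadd φ hφ hMA hR hρR hnₛ hqa₂ ha₂ρ hd
  -- `nₛ + q aᵢ + (n − nₛ) = n + q aᵢ`
  have e1 : nₛ + (q : ℤ) * a₁ + (n - nₛ) = n + (q : ℤ) * a₁ := by ring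
  have e2 : nₛ + (q : ℤ) * a₂ + (n - nₛ) = n + (q : ℤ) * a₂ := by ring
  have e3 : nₛ + (n - nₛ) = n := by ring
  rw [e1, e3] at L1
  rw [e2, e3] at L2
  have key : φ n - φ (n + (q : ℤ) * a₁ + (q : ℤ) * a₂) + φ (nₛ + (q : ℤ) * a₁) + φ (nₛ + (q : ℤ) * a₂)
      - 2 • φ nₛ =
      -((φ (n + (q : ℤ) * a₁ + (q : ℤ) * a₂) - φ (n + (q : ℤ) * a₁) - φ (n + (q : ℤ) * a₂) + φ n) +
        (φ (n + (q : ℤ) * a₁) - φ (nₛ + (q : ℤ) * a₁) - φ n + φ nₛ) +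
        (φ (n + (q : ℤ) * a₂) - φ (nₛ + (q : ℤ) * a₂) - φ n + φ nₛ)) := by
    rw [two_nsmul]; abel
  rw [key, norm_neg]
  calc _ ≤ ‖(φ (n + (q : ℤ) * a₁ + (q : ℤ) * a₂) - φ (n + (q : ℤ) * a₁) - φ (n + (q : ℤ) * a₂) + φ n) +
        (φ (n + (q : ℤ) * a₁) - φ (nₛ + (q : ℤ) * a₁) - φ n + φ nₛ)‖ +
        ‖φ (n + (q : ℤ) * a₂) - φ (nₛ + (q : ℤ) * a₂) - φ n + φ nₛ‖ := norm_add_le _ _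
    _ ≤ (‖φ (n + (q : ℤ) * a₁ + (q : ℤ) * a₂) - φ (n + (q : ℤ) * a₁) - φ (n + (q : ℤ) * a₂) + φ n‖ +
        ‖φ (n + (q : ℤ) * a₁) - φ (nₛ + (q : ℤ) * a₁) - φ n + φ nₛ‖) +
        ‖φ (n + (q : ℤ) * a₂) - φ (nₛ + (q : ℤ) * a₂) - φ n + φ nₛ‖ :=
        add_le_add (norm_add_le _ _) le_rfl
    _ ≤ (K * ν a₁ * ν ((q : ℤ) * a₂) + K * ν a₁ * ν (n - nₛ)) + K * ν a₂ * ν (n - nₛ) :=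
        add_le_add (add_le_add L3 L1) L2
    _ ≤ (K * η * (q * η) + K * η * (2 * r)) + K * η * (2 * r) := by
        have h1 : K * ν a₁ * ν ((q : ℤ) * a₂) ≤ K * η * (q * η) := by
          have := hνnn a₁; have := hνnn ((q : ℤ) * a₂)
          calc K * ν a₁ * ν ((q : ℤ) * a₂) ≤ K * η * ν ((q : ℤ) * a₂) := by
                apply mul_le_mul_of_nonneg_right _ this
                exact mul_le_mul_of_nonneg_left ha₁.le hK
            _ ≤ K * η * (q * η) := mul_le_mul_of_nonneg_left hqa₂η (by positivity)
        have h2 : ∀ a : ℤ, ν a < η → K * ν a * ν (n - nₛ) ≤ K * η * (2 * r) := by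
          intro a ha
          have := hνnn a; have := hνnn (n - nₛ)
          calc K * ν a * ν (n - nₛ) ≤ K * η * ν (n - nₛ) := by
                apply mul_le_mul_of_nonneg_right _ this
                exact mul_le_mul_of_nonneg_left ha.le hK
            _ ≤ K * η * (2 * r) := mul_le_mul_of_nonneg_left hclose.le (by positivity)
        exact add_le_add (add_le_add h1 (h2 a₁ ha₁)) (h2 a₂ ha₂)
    _ = K * η * (q * η + 4 * r) := by ring

end Summit.Parity.GeneralizedHardyLittlewood.GreenTaoLevelTwoMNTwoMajorArcThreeTerm
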